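import Literature.Probability.RandomPlanarGeometry.SLEKappaRhoMartingaleReduction
import Literature.Probability.RandomPlanarGeometry.LocalMartingaleProofs
import Literature.Probability.Process.NestedStoppedMartingales
import Literature.Probability.Process.MartingaleLimit
import HarnessLib

/-!
# [LSW] Lemma 8.9, the end-game: from localised martingales to the martingale extension of `M_t`

G. F. Lawler, O. Schramm, W. Werner, *Conformal restriction: the chordal case*, J. Amer. Math.
Soc. **16** (2003) 917–955, arXiv:math/0209343 (**[LSW]**), §8.4: Lemma 8.9 ("`(M_t, t < T)` is a
local martingale") and the end of the proof of Thm. 8.4 ("since `M_t` converges a.s. and in `L¹`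
when `t → T`"), for `M_t = h_t'(W_t)^{5/8} h_t'(O_t)^b [(h_t(W_t) − h_t(O_t))/(W_t − O_t)]^c` along
an SLE(8/3, ρ) pair and a smooth hull `A ∈ 𝒬₊`.

The tree reduces the named fact `SLEKappaRho.exists_isOneSidedMartingale` (Lemmas 8.9/8.10 with
the convergence clause) to the existence of a MARTINGALE EXTENSION of the explicit functional
`oneSidedM ρ (A_t − W_t) (O_t − W_t)` (`SLEKappaRho.IsMartingaleExtension`,
`SLEKappaRho.exists_isOneSidedMartingale_of_extension'`, Lemma 8.10 being proved:
`SLEKappaRhoLemma810`). A proof of Lemma 8.9 — by Itô's formula as printed, or by conditional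
increments as in the tree's `SLEKappaRho.CellScheme.martingale_stoppedProcess`
(`SLEKappaRhoCellMartingale`) — delivers the local martingale in LOCALISED form: a sequence of
stopping times `τ₀ ≤ τ₁ ≤ ⋯` exhausting `[0, T_A)` and, for each `k`, a `[0, 1]`-valued process `Yᵏ`
(the functional read along a level-`k` regularised driver) whose stopped process `(Yᵏ)^{τ_k}` is a
martingale with a.s. continuous paths, the `Yᵏ` agreeing with each other up to `τ_k` and with
`M_t` before `τ_k`. This file PROVES the passage from such data to the martingale extension, i.e.
the sentence "since `M_t` converges a.s. and in `L¹` when `t → T`" in the generality of a raw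
(neither completed nor right-continuous) Brownian filtration:

* `SLEKappaRho.IsLocalisingFamily Y τ` — the hypothesis bundle just described (no reference to
  SLE: values in `[0, 1]`, nested finite stopping times, stopped martingales with a.s. continuous
  paths, locality `Yᴶ = Yᵏ` on `[0, τ_k]` for `k ≤ J`);
* `SLEKappaRho.nestedLim Y τ` — the limit process `limsup_k (Yᵏ)^{τ_k}_t`; under the bundle it is a
  `[0, 1]`-valued MARTINGALE (`IsLocalisingFamily.martingale_nestedLim`: the stopped processes are
  a.s. uniformly Cauchy, `Literature.Probability.Process.ae_nested_stoppedProcess_cauchy` applied to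
  the glued process `SLEKappaRho.glue`, and bounded a.s. limits of martingales are martingales,
  `Literature.Probability.Process.martingale_of_tendsto_of_abs_le`), with a.s. CONTINUOUS paths
  (uniform limit), a.s. convergent as `t → ∞` (`ae_exists_tendsto_nestedLim`);
* `IsLocalisingFamily.isMartingaleExtension` — **if moreover, almost surely, the `τ_k` do not
  exceed the hitting time `T_A` of `A` by the closed hulls of `W`, every time `t < T_A` is `< τ_k`
  for some `k`, and `Yᵏ_t = oneSidedM ρ (A_t − W_t) (O_t − W_t)` for `t < τ_k`, then `nestedLim Y τ`
  is a martingale extension of [LSW]'s `M`** (`IsMartingaleExtension ρ A O W ·`): it equals the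
  functional before `T_A`, is frozen (indeed continuous) at `T_A`, and converges at `∞`;
* `SLEKappaRho.exists_isOneSidedMartingale_of_localisingFamily` — hence the named fact follows
  from the existence of such a family for every SLE(8/3, ρ) pair (`ρ > −2`) and every nonempty
  smooth `A ∈ 𝒬₊`.

No new definition of mathematical content beyond the two explicit processes `glue`, `nestedLim`;
no named fact.

## References

* [LSW] §8.4: Lemma 8.9 and the end of the proof of Thm. 8.4; §6, proof of Thm. 6.1 ("By the
  martingale convergence theorem, the a.s. limit `Y_T := lim_{t ↗ T} Y_t` exists").
  [LawlerSchrammWerner2003Restriction]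
* D. Revuz, M. Yor, *Continuous Martingales and Brownian Motion* (3rd ed., 1999), Ch. II
  Thm (2.10), Ch. IV Prop. (1.23). [RevuzYor1999]
-/

noncomputable section

open Set Filter Topology MeasureTheory
open scoped NNReal ENNReal
open Literature.Probability.Process (preWienerMeasure)

namespace Literature.Probability.RandomPlanarGeometry

namespace SLEKappaRho

/-! ### Gluing a nested family of stopped processes into one process -/

section Glue

variable {Ω : Type*} {X : ℕ → ℝ≥0 → Ω → ℝ} {τ : ℕ → Ω → WithTop ℝ≥0}

open Classical in
/-- **The glued process** of a family `Xᵏ` of processes stopped at times `τ_k`: at `(t, ω)` the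
value `Xᵏ_t(ω)` for the least `k` with `t ≤ τ_k(ω)` (and `0` if there is none). For a nested
family (`(Xᴶ)^{τ_k} = Xᵏ`, `k ≤ J`) it is a single process whose stopped processes are the `Xᵏ`
(`stoppedProcess_glue`). [folklore] -/
def glue (X : ℕ → ℝ≥0 → Ω → ℝ) (τ : ℕ → Ω → WithTop ℝ≥0) (t : ℝ≥0) (ω : Ω) : ℝ :=
  if h : ∃ k, (t : WithTop ℝ≥0) ≤ τ k ω then X (Nat.find h) t ω else 0

/-- Before `τ_k` the glued process is `Xᵏ` (nesting). [folklore] -/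
theorem glue_eq_of_le (hnest : ∀ ⦃k J : ℕ⦄, k ≤ J → stoppedProcess (X J) (τ k) = X k)
    {k : ℕ} {t : ℝ≥0} {ω : Ω} (ht : (t : WithTop ℝ≥0) ≤ τ k ω) : glue X τ t ω = X k t ω := by
  classical
  have h : ∃ j, (t : WithTop ℝ≥0) ≤ τ j ω := ⟨k, ht⟩
  rw [glue, dif_pos h]
  have hj : Nat.find h ≤ k := Nat.find_min' h ht
  have hjt : (t : WithTop ℝ≥0) ≤ τ (Nat.find h) ω := Nat.find_spec h
  have h1 := congrFun (congrFun (hnest hj) t) ω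
  rw [stoppedProcess_eq_of_le hjt] at h1
  exact h1.symm

/-- `|glue| ≤ 1` for `[0, 1]`-valued `Xᵏ`. [folklore] -/
theorem abs_glue_le_one (hX : ∀ k t ω, X k t ω ∈ Icc (0 : ℝ) 1) (t : ℝ≥0) (ω : Ω) :
    |glue X τ t ω| ≤ 1 := by
  classical
  unfold glue
  split_ifs with h
  · exact abs_le.2 ⟨by linarith [(hX (Nat.find h) t ω).1], (hX (Nat.find h) t ω).2⟩
  · simp

/-- **The stopped processes of the glued process are the `Xᵏ`**, for a nested family of processes
stopped at finite times. [folklore] -/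
theorem stoppedProcess_glue (hfin : ∀ k ω, τ k ω ≠ ⊤)
    (hnest : ∀ ⦃k J : ℕ⦄, k ≤ J → stoppedProcess (X J) (τ k) = X k) (k : ℕ) :
    stoppedProcess (glue X τ) (τ k) = X k := by
  funext t ω
  rcases le_or_gt (t : WithTop ℝ≥0) (τ k ω) with ht | ht
  · rw [stoppedProcess_eq_of_le ht, glue_eq_of_le hnest ht]
  · obtain ⟨t₀, ht₀⟩ := WithTop.ne_top_iff_exists.1 (hfin k ω)
    have h2 := congrFun (congrFun (hnest (le_refl k)) t) ω
    rw [stoppedProcess_eq_of_ge ht.le, ← ht₀] at h2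
    rw [stoppedProcess_eq_of_ge ht.le, ← ht₀, ← h2]
    exact glue_eq_of_le hnest (k := k) (by rw [← ht₀]; rfl)

end Glue

/-! ### Localising families -/

section Family

variable {Y : ℕ → ℝ≥0 → (ℝ≥0 → ℝ) → ℝ} {τ : ℕ → (ℝ≥0 → ℝ) → WithTop ℝ≥0}

/-- **A localising family for a bounded local martingale on the canonical space** (hypothesis
bundle, not asserted): `[0, 1]`-valued processes `Yᵏ` and finite stopping times
`τ₀ ≤ τ₁ ≤ ⋯` of the raw Brownian filtration such that every stopped process `(Yᵏ)^{τ_k}` is a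
martingale with almost surely continuous paths, and `Yᴶ = Yᵏ` on `[0, τ_k]` for `k ≤ J`
(locality: the level-`J` process refines the level-`k` one). This is the output format of a proof of
[LSW] Lemma 8.9 along localising stopping times.
[cite: LawlerSchrammWerner2003Restriction, §8.4 Lemma 8.9 ("(M_t, t < T) is a local martingale")] -/
structure IsLocalisingFamily (Y : ℕ → ℝ≥0 → (ℝ≥0 → ℝ) → ℝ) (τ : ℕ → (ℝ≥0 → ℝ) → WithTop ℝ≥0) :
    Prop where
  /-- `0 ≤ Yᵏ ≤ 1`. -/
  mem_Icc : ∀ k t ω, Y k t ω ∈ Icc (0 : ℝ) 1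
  /-- `τ_k ≤ τ_{k+1}`. -/
  mono : ∀ k ω, τ k ω ≤ τ (k + 1) ω
  /-- every `τ_k` is finite. -/
  ne_top : ∀ k ω, τ k ω ≠ ⊤
  /-- every `τ_k` is a stopping time of the Brownian filtration. -/
  isStoppingTime : ∀ k, IsStoppingTime brownianFiltration (τ k)
  /-- `(Yᵏ)^{τ_k}` is a martingale. -/
  martingale : ∀ k, Martingale (stoppedProcess (Y k) (τ k)) brownianFiltration preWienerMeasure
  /-- almost every path of `(Yᵏ)^{τ_k}` is continuous. -/
  ae_continuous : ∀ k, ∀ᵐ ω ∂preWienerMeasure, Continuous fun t ↦ stoppedProcess (Y k) (τ k) t ω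
  /-- locality: `Yᴶ_t = Yᵏ_t` for `t ≤ τ_k`, `k ≤ J`. -/
  locality : ∀ ⦃k J : ℕ⦄, k ≤ J → ∀ (t : ℝ≥0) (ω : ℝ≥0 → ℝ), (t : WithTop ℝ≥0) ≤ τ k ω →
    Y J t ω = Y k t ω

/-- **The limit process** `limsup_k (Yᵏ)^{τ_k}_t` of a localising family (the a.s. limit; under
`IsLocalisingFamily` a bounded martingale with a.s. continuous paths).
[cite: LawlerSchrammWerner2003Restriction, end of the proof of Thm. 8.4 ("M_t converges a.s. and in L¹ when t → T")] -/
def nestedLim (Y : ℕ → ℝ≥0 → (ℝ≥0 → ℝ) → ℝ) (τ : ℕ → (ℝ≥0 → ℝ) → WithTop ℝ≥0) (t : ℝ≥0)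
    (ω : ℝ≥0 → ℝ) : ℝ :=
  limsup (fun k ↦ stoppedProcess (Y k) (τ k) t ω) atTop

/-- A Cauchy sequence of reals converges to its `limsup`. [folklore] -/
private theorem tendsto_limsup_of_cauchy' {x : ℕ → ℝ}
    (hc : ∀ ε : ℝ, 0 < ε → ∃ K, ∀ k, K ≤ k → ∀ J, k ≤ J → |x J - x k| ≤ ε) :
    Tendsto x atTop (𝓝 (limsup x atTop)) := by
  have hcs : CauchySeq x := by
    rw [Metric.cauchySeq_iff']
    intro ε hε
    obtain ⟨K, hK⟩ := hc (ε / 2) (by positivity)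
    refine ⟨K, fun J hJ ↦ ?_⟩
    rw [Real.dist_eq]
    exact lt_of_le_of_lt (hK K le_rfl J hJ) (by linarith)
  obtain ⟨c, hc'⟩ := cauchySeq_tendsto_of_complete hcs
  rwa [hc'.limsup_eq]

namespace IsLocalisingFamily

variable (h : IsLocalisingFamily Y τ)
include h

/-- `k ↦ τ_k(ω)` is non-decreasing. [folklore] -/
theorem monotone (ω : ℝ≥0 → ℝ) : Monotone (τ · ω) :=
  monotone_nat_of_le_succ fun k ↦ h.mono k ω

/-- The stopped processes take values in `[0, 1]`. [folklore] -/
theorem stoppedProcess_mem_Icc (k : ℕ) (t : ℝ≥0) (ω : ℝ≥0 → ℝ) :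
    stoppedProcess (Y k) (τ k) t ω ∈ Icc (0 : ℝ) 1 := by
  simp only [stoppedProcess]
  exact h.mem_Icc _ _ _

/-- `|(Yᵏ)^{τ_k}| ≤ 1`. [folklore] -/
theorem abs_stoppedProcess_le (k : ℕ) (t : ℝ≥0) (ω : ℝ≥0 → ℝ) :
    |stoppedProcess (Y k) (τ k) t ω| ≤ 1 := by
  have := h.stoppedProcess_mem_Icc k t ω
  exact abs_le.2 ⟨by linarith [this.1], this.2⟩

/-- **Nesting**: `((Yᴶ)^{τ_J})^{τ_k} = (Yᵏ)^{τ_k}` for `k ≤ J` (monotonicity of the times and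
locality of the processes). [folklore] -/
theorem nested ⦃k J : ℕ⦄ (hkJ : k ≤ J) :
    stoppedProcess (stoppedProcess (Y J) (τ J)) (τ k) = stoppedProcess (Y k) (τ k) := by
  rw [Process.stoppedProcess_stoppedProcess_of_le (fun ω ↦ h.monotone ω hkJ)]
  funext t ω
  simp only [stoppedProcess]
  apply h.locality hkJ
  rw [Process.coe_untopA_min]
  exact min_le_right _ _

/-- The glued process of the family has the `(Yᵏ)^{τ_k}` as stopped processes. [folklore] -/
theorem stoppedProcess_glue_eq (k : ℕ) :
    stoppedProcess (glue (fun k ↦ stoppedProcess (Y k) (τ k)) τ) (τ k) = stoppedProcess (Y k) (τ k) :=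
  stoppedProcess_glue h.ne_top h.nested k

/-- **The stopped processes are a.s. uniformly Cauchy** (`Process.ae_nested_stoppedProcess_cauchy`
for the glued process): a.s., for every `ε > 0`, for `k` large and all `J ≥ k`,
`sup_r |(Yᴶ)^{τ_J}_r − (Yᵏ)^{τ_k}_r| ≤ ε`. [cite: RevuzYor1999, Ch. II Thm (2.10)] -/
theorem ae_cauchy : ∀ᵐ ω ∂preWienerMeasure, ∀ ε : ℝ, 0 < ε → ∃ K : ℕ, ∀ k, K ≤ k → ∀ J, k ≤ J →
    ∀ r : ℝ≥0, |stoppedProcess (Y J) (τ J) r ω - stoppedProcess (Y k) (τ k) r ω| ≤ ε := by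
  haveI := isProbabilityMeasure_preWienerMeasure'
  have hg := h.stoppedProcess_glue_eq
  have := Process.ae_nested_stoppedProcess_cauchy
    (Y := glue (fun k ↦ stoppedProcess (Y k) (τ k)) τ) (τ := τ) (P := preWienerMeasure)
    (𝓕 := brownianFiltration) (C := 1) h.monotone (fun k ↦ (h.isStoppingTime k).isOptionalTime)
    (fun k ↦ by rw [hg]; exact h.martingale k)
    (fun t ω ↦ abs_glue_le_one (fun k t ω ↦ h.stoppedProcess_mem_Icc k t ω) t ω)
    (fun k ↦ by rw [hg]; exact h.ae_continuous k)
  simpa only [hg] using this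

/-- `0 ≤ nestedLim ≤ 1`. [folklore] -/
theorem nestedLim_mem_Icc (t : ℝ≥0) (ω : ℝ≥0 → ℝ) : nestedLim Y τ t ω ∈ Icc (0 : ℝ) 1 := by
  rw [nestedLim]
  have hb1 : ∀ k : ℕ, stoppedProcess (Y k) (τ k) t ω ≤ 1 := fun k ↦ (h.stoppedProcess_mem_Icc k t ω).2
  have hb0 : ∀ k : ℕ, 0 ≤ stoppedProcess (Y k) (τ k) t ω := fun k ↦ (h.stoppedProcess_mem_Icc k t ω).1
  have hbdd : IsBoundedUnder (· ≤ ·) atTop fun k : ℕ ↦ stoppedProcess (Y k) (τ k) t ω :=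
    ⟨1, eventually_map.2 (Eventually.of_forall hb1)⟩
  have hbddb : IsBoundedUnder (· ≥ ·) atTop fun k : ℕ ↦ stoppedProcess (Y k) (τ k) t ω :=
    ⟨0, eventually_map.2 (Eventually.of_forall hb0)⟩
  exact ⟨le_limsup_of_frequently_le (Frequently.of_forall hb0) hbdd,
    limsup_le_of_le hbddb.isCoboundedUnder_le (Eventually.of_forall hb1)⟩

/-- `nestedLim` is strongly adapted (a `limsup` of adapted processes). [folklore] -/
theorem stronglyAdapted_nestedLim : StronglyAdapted brownianFiltration (nestedLim Y τ) := fun t ↦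
  (Measurable.limsup fun k ↦ ((h.martingale k).stronglyMeasurable t).measurable).stronglyMeasurable

/-- **A.s., the stopped processes converge to `nestedLim` at every time.** [folklore] -/
theorem ae_tendsto_nestedLim : ∀ᵐ ω ∂preWienerMeasure, ∀ t : ℝ≥0,
    Tendsto (fun k ↦ stoppedProcess (Y k) (τ k) t ω) atTop (𝓝 (nestedLim Y τ t ω)) := by
  filter_upwards [h.ae_cauchy] with ω hω t
  exact tendsto_limsup_of_cauchy' fun ε hε ↦ (hω ε hε).imp fun K hK k hk J hJ ↦ hK k hk J hJ t

/-- **`nestedLim` is a martingale** (bounded a.s. limit of the martingales `(Yᵏ)^{τ_k}`).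
[cite: LawlerSchrammWerner2003Restriction, end of the proof of Thm. 8.4 ("M_t converges a.s. and in L¹")] -/
theorem martingale_nestedLim : Martingale (nestedLim Y τ) brownianFiltration preWienerMeasure := by
  haveI := isProbabilityMeasure_preWienerMeasure'
  refine Process.martingale_of_tendsto_of_abs_le (M := fun k ↦ stoppedProcess (Y k) (τ k)) h.martingale
    (C := fun _ ↦ 1) (fun k t ω ↦ h.abs_stoppedProcess_le k t ω) (fun t ↦ ?_) h.stronglyAdapted_nestedLim
  filter_upwards [h.ae_tendsto_nestedLim] with ω hω using hω t

/-- **A.s., `(Yᵏ)^{τ_k} → nestedLim` uniformly in time.** [folklore] -/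
theorem ae_tendstoUniformly : ∀ᵐ ω ∂preWienerMeasure,
    TendstoUniformly (fun k r ↦ stoppedProcess (Y k) (τ k) r ω) (fun r ↦ nestedLim Y τ r ω) atTop := by
  filter_upwards [h.ae_cauchy, h.ae_tendsto_nestedLim] with ω hω hlim
  rw [Metric.tendstoUniformly_iff]
  intro ε hε
  obtain ⟨K, hK⟩ := hω (ε / 2) (half_pos hε)
  refine eventually_atTop.2 ⟨K, fun k hk r ↦ ?_⟩
  have h1 : |nestedLim Y τ r ω - stoppedProcess (Y k) (τ k) r ω| ≤ ε / 2 :=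
    le_of_tendsto ((continuous_abs.tendsto _).comp ((hlim r).sub tendsto_const_nhds))
      (eventually_atTop.2 ⟨k, fun J hJ ↦ hK k hk J hJ r⟩)
  rw [Real.dist_eq]
  linarith

/-- **Almost every path of `nestedLim` is continuous** (uniform limit of continuous paths).
[folklore] -/
theorem ae_continuous_nestedLim : ∀ᵐ ω ∂preWienerMeasure, Continuous fun t ↦ nestedLim Y τ t ω := by
  have hc : ∀ᵐ ω ∂preWienerMeasure, ∀ k, Continuous fun t ↦ stoppedProcess (Y k) (τ k) t ω :=
    ae_all_iff.2 h.ae_continuous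
  filter_upwards [h.ae_tendstoUniformly, hc] with ω hω hc
  exact hω.continuous (Frequently.of_forall hc)

/-- **A.s., `lim_{t → ∞} nestedLim_t` exists** (the terminal limit along the finite stopping
times, `Process.ae_nested_stoppedProcess_tendsto`). [cite: RevuzYor1999, Ch. II Thm (2.10)] -/
theorem ae_exists_tendsto_nestedLim : ∀ᵐ ω ∂preWienerMeasure,
    ∃ c : ℝ, Tendsto (fun t ↦ nestedLim Y τ t ω) atTop (𝓝 c) := by
  haveI := isProbabilityMeasure_preWienerMeasure'
  have hg := h.stoppedProcess_glue_eq
  have hlim := Process.ae_nested_stoppedProcess_tendsto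
    (Y := glue (fun k ↦ stoppedProcess (Y k) (τ k)) τ) (τ := τ) (P := preWienerMeasure)
    (𝓕 := brownianFiltration) (C := 1) h.monotone (fun k ↦ (h.isStoppingTime k).isOptionalTime)
    (fun k ↦ by rw [hg]; exact h.martingale k)
    (fun t ω ↦ abs_glue_le_one (fun k t ω ↦ h.stoppedProcess_mem_Icc k t ω) t ω)
    (fun k ↦ by rw [hg]; exact h.ae_continuous k)
  simp only [hg] at hlim
  filter_upwards [hlim, h.ae_tendsto_nestedLim] with ω hω hl
  obtain ⟨c, hc⟩ := hω fun k ↦ h.ne_top k ω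
  refine ⟨c, Metric.tendsto_atTop.2 fun ε hε ↦ ?_⟩
  obtain ⟨K, hK⟩ := hc (ε / 2) (half_pos hε)
  obtain ⟨r₀, hr₀⟩ := WithTop.ne_top_iff_exists.1 (h.ne_top K ω)
  refine ⟨r₀, fun r hr ↦ ?_⟩
  have hKr : τ K ω ≤ r := by rw [← hr₀]; exact_mod_cast hr
  have h1 : |nestedLim Y τ r ω - c| ≤ ε / 2 :=
    le_of_tendsto ((continuous_abs.tendsto _).comp ((hl r).sub tendsto_const_nhds))
      (eventually_atTop.2 ⟨K, fun J hJ ↦ hK J hJ r hKr⟩)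
  rw [Real.dist_eq]
  linarith

/-- **From localised martingales to the martingale extension of [LSW]'s `M_t`.** If, almost surely,
the localising times do not exceed the hitting time `T_A` of `A` by the closed hulls of `W`, every
`t < T_A` is `< τ_k` for some `k`, and `Yᵏ_t = oneSidedM ρ (A_t − W_t) (O_t − W_t)` for `t < τ_k`,
then `nestedLim Y τ` is a martingale extension of the functional: a `[0, 1]`-valued martingale equal
to `M_t` before `T_A`, frozen at `T_A` (its paths are a.s. continuous), convergent at `∞`.
[cite: LawlerSchrammWerner2003Restriction, §8.4: Lemma 8.9 and the end of the proof of Thm. 8.4] -/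
theorem isMartingaleExtension {ρ : ℝ} {A : Set ℂ} {O W : ℝ≥0 → (ℝ≥0 → ℝ) → ℝ}
    (hle : ∀ᵐ ω ∂preWienerMeasure, ∀ k, τ k ω ≤ Loewner.hullHitTime (fun s ↦ W s ω) A)
    (hexh : ∀ᵐ ω ∂preWienerMeasure, ∀ t : ℝ≥0,
      (t : WithTop ℝ≥0) < Loewner.hullHitTime (fun s ↦ W s ω) A → ∃ k, (t : WithTop ℝ≥0) < τ k ω)
    (hval : ∀ᵐ ω ∂preWienerMeasure, ∀ (k : ℕ) (t : ℝ≥0), (t : WithTop ℝ≥0) < τ k ω →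
      Y k t ω = oneSidedM ρ (Loewner.slidHull (fun s ↦ W s ω) A t) (O t ω - W t ω)) :
    IsMartingaleExtension ρ A O W (nestedLim Y τ) where
  mem_Icc := h.nestedLim_mem_Icc
  martingale := h.martingale_nestedLim
  ae_eq_oneSidedM := by
    filter_upwards [hexh, hval] with ω hexh hval t ht
    obtain ⟨k, hk⟩ := hexh t ht
    have hev : ∀ᶠ J in atTop, stoppedProcess (Y J) (τ J) t ω =
        oneSidedM ρ (Loewner.slidHull (fun s ↦ W s ω) A t) (O t ω - W t ω) := by
      filter_upwards [eventually_ge_atTop k] with J hJ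
      have htJ : (t : WithTop ℝ≥0) ≤ τ J ω := hk.le.trans (h.monotone ω hJ)
      rw [stoppedProcess_eq_of_le htJ, h.locality hJ t ω hk.le, hval k t hk]
    exact (tendsto_const_nhds.congr' (EventuallyEq.symm hev)).limsup_eq
  ae_frozen := by
    filter_upwards [hle, h.ae_continuous_nestedLim] with ω hle hcont τ₀ hτ₀ t ht
    have hfrz : nestedLim Y τ t ω = nestedLim Y τ τ₀ ω := by
      simp only [nestedLim]
      congr 1
      funext k
      have hk : τ k ω ≤ τ₀ := by have := hle k; rwa [hτ₀] at this
      exact Process.stoppedProcess_eq_of_le_of_le (hk.trans (by exact_mod_cast ht)) hk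
    rw [hfrz]
    exact (hcont.tendsto τ₀).mono_left nhdsWithin_le_nhds
  ae_exists_tendsto := by
    filter_upwards [h.ae_exists_tendsto_nestedLim] with ω hω _ using hω

/-- The existential form. [cite: LawlerSchrammWerner2003Restriction, §8.4: Lemma 8.9 and the end of the proof of Thm. 8.4] -/
theorem exists_isMartingaleExtension {ρ : ℝ} {A : Set ℂ} {O W : ℝ≥0 → (ℝ≥0 → ℝ) → ℝ}
    (hle : ∀ᵐ ω ∂preWienerMeasure, ∀ k, τ k ω ≤ Loewner.hullHitTime (fun s ↦ W s ω) A)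
    (hexh : ∀ᵐ ω ∂preWienerMeasure, ∀ t : ℝ≥0,
      (t : WithTop ℝ≥0) < Loewner.hullHitTime (fun s ↦ W s ω) A → ∃ k, (t : WithTop ℝ≥0) < τ k ω)
    (hval : ∀ᵐ ω ∂preWienerMeasure, ∀ (k : ℕ) (t : ℝ≥0), (t : WithTop ℝ≥0) < τ k ω →
      Y k t ω = oneSidedM ρ (Loewner.slidHull (fun s ↦ W s ω) A t) (O t ω - W t ω)) :
    ∃ M, IsMartingaleExtension ρ A O W M :=
  ⟨_, h.isMartingaleExtension hle hexh hval⟩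

end IsLocalisingFamily

end Family

/-- **`exists_isOneSidedMartingale` from localising families** ([LSW] Lemma 8.9 in localised form
for every SLE(8/3, ρ) pair, `ρ > −2`, and every nonempty smooth `A ∈ 𝒬₊`, plus the end of the proof
of Thm. 8.4; Lemma 8.10 and the empty hull are supplied by the tree,
`exists_isOneSidedMartingale_of_extension'`).
[cite: LawlerSchrammWerner2003Restriction, §8.4: Lemma 8.9, Lemma 8.10, end of the proof of Thm. 8.4] -/
theorem exists_isOneSidedMartingale_of_localisingFamily
    (hfam : ∀ {ρ : ℝ} {O W : ℝ≥0 → (ℝ≥0 → ℝ) → ℝ}, -2 < ρ → IsSLEKappaRhoPair (8 / 3) ρ O W →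
      ∀ {A : Set ℂ}, IsSmoothHull A → IsPlusHull A → A.Nonempty →
        ∃ (Y : ℕ → ℝ≥0 → (ℝ≥0 → ℝ) → ℝ) (τ : ℕ → (ℝ≥0 → ℝ) → WithTop ℝ≥0),
          IsLocalisingFamily Y τ ∧
          (∀ᵐ ω ∂preWienerMeasure, ∀ k, τ k ω ≤ Loewner.hullHitTime (fun s ↦ W s ω) A) ∧
          (∀ᵐ ω ∂preWienerMeasure, ∀ t : ℝ≥0,
            (t : WithTop ℝ≥0) < Loewner.hullHitTime (fun s ↦ W s ω) A → ∃ k, (t : WithTop ℝ≥0) < τ k ω) ∧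
          (∀ᵐ ω ∂preWienerMeasure, ∀ (k : ℕ) (t : ℝ≥0), (t : WithTop ℝ≥0) < τ k ω →
            Y k t ω = oneSidedM ρ (Loewner.slidHull (fun s ↦ W s ω) A t) (O t ω - W t ω))) :
    exists_isOneSidedMartingale :=
  exists_isOneSidedMartingale_of_extension' fun hρ hOW _ hAs hA hne ↦ by
    obtain ⟨Y, τ, h, h1, h2, h3⟩ := hfam hρ hOW hAs hA hne
    exact h.exists_isMartingaleExtension h1 h2 h3

end SLEKappaRho

end Literature.Probability.RandomPlanarGeometry

end
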